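import Summits.HubbardSuperconductivity.HubbardSuperconductivity.Theorems.FunctionFieldCertificateWindowInfraredBoundEtaGapDomination
import Literature.MathematicalPhysics.QuantumLattice.HubbardGaugeBound
import Literature.Probability.LatticeModels.TorusGreenHeatKernel

/-!
# Crux `WindowInfraredBound` (stmt-HubbardSuperconductivity-1089) — the `η`-channel calibration, part 2:
# an RP-free `T = 0` FLAT window law for on-site pairs near `Q = (π, π)` in every sector ground state

Continues `…EtaGapDomination.lean` (`[H, Δ_s(p)] = 2t Δ_{s*}(p) − U Δ_s(p)` and the pointwise `η`-gap domination
`(U − (E_N − E_{N−2})) ‖Δ_s(p)ψ‖ ≤ 2|t| ‖Δ_{s*}(p)ψ‖`). Here (`Δ_g(p) = pairFieldAt g L p`, `s* = extendedSWave`):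

* `pairFieldAt_extendedSWave_eq_sum_single` — `Δ_{s*}(p) = (1/√2) Σ_i (1 + conj χ_p(e_i)) T_i(p)` with the bond
  modes `T_i(p) = Σ_x conj χ_p(x) (c_{x↑}c_{x+e_i,↓} − c_{x↓}c_{x+e_i,↑})`; at `Q = (π,π)` on an even torus
  `χ_Q(e_i) = −1` (`torusChar_piPi_single`), so the extended-`s` weight VANISHES there, linearly:
  `‖Δ_{s*}(Q+q)ψ‖² ≤ |q|² Σ_i ‖T_i(Q+q)ψ‖²` (`eucNorm_sq_pairFieldAt_extendedSWave_piPi_add_le`);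
* `ewb_sum_eucNorm_sq_fourierMode_le` — Parseval for operator-valued Fourier modes in a vector:
  `Σ_p ‖A(p)ψ‖² ≤ K² L⁴ ‖ψ‖²` if `‖A_x‖ ≤ K`; hence `Σ_{|q|≤ε} ‖Δ_{s*}(Q+q)ψ‖² ≤ 8 ε² L⁴ ‖ψ‖²` for EVERY vector
  (`windowSum_extendedSWave_piPi_le`, pure kinematics);
* `etaWindowBound` — the registered support: if the `η`-mode is gapped, `E_N − E_{N−2} < U`, then
  `Σ_{q ≠ 0, |q| ≤ ε} S^{sWave}_ψ(Q+q) ≤ 32 t² ε² L² / (U − (E_N − E_{N−2}))²` in every normalised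
  `(N, S^z = M)`-sector ground state of `hubbardTorus 2 L t U` (even `L ≥ 4`, `N ≥ 2`): the FLAT window law
  `C ε² L²` of a gapped mode (pole order ZERO) in the exact shape of the crux's window functional
  (`S = pairStructureFactor`, `|q|² = momentumNormSq`), with no reflection positivity, at every coupling and filling.

The crux's `d`-wave channel has no lowering eigen-operator; its law is the Goldstone `C ε L²` (pole order one) and
stays open. Sources: C. N. Yang, PRL 63 (1989) 2144; B. S. Shastry, J. Phys. A 30 (1997) L635; T. Kennedy,
E. H. Lieb, B. S. Shastry, PRL 61 (1988) 2582 (sum rule); L. Pitaevskii, S. Stringari, J. Low Temp. Phys. 85 (1991)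
377. Folklore finite-dimensional bookkeeping; no definition and no named fact is introduced.
-/

noncomputable section

-- the mandated namespace repeats `HubbardSuperconductivity` (single-problem summit, D-0017)
set_option linter.dupNamespace false

namespace Summit.HubbardSuperconductivity.HubbardSuperconductivity.Theorems.WindowInfraredBound

open Matrix Finset
open Literature.Probability.LatticeModels Literature.MathematicalPhysics.QuantumLattice
open Literature.MathematicalPhysics.QuantumLattice.EigenvalueContinuation (re_star_dotProduct_self_nonneg)
open scoped ComplexOrder ComplexConjugate Matrix.Norms.L2Operator

/-! ## §3 Kinematics: the extended-`s` pair field has no weight at `Q = (π,π)` -/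

section Kinematics

variable {L : ℕ} [NeZero L]

/-- The singlet bond annihilator is symmetric in its two sites:
`c_{u↑}c_{v↓} − c_{u↓}c_{v↑} = c_{v↑}c_{u↓} − c_{v↓}c_{u↑}`. Scalapino (1995) §2. [folklore] -/
theorem ewb_bond_symm {Λ : Type*} [LinearOrder Λ] [Fintype Λ] (u v : Λ) :
    (annihilation (orb u 0) * annihilation (orb v 1) - annihilation (orb u 1) * annihilation (orb v 0) :
        Matrix (Finset (Orb Λ)) (Finset (Orb Λ)) ℂ) =
      annihilation (orb v 0) * annihilation (orb u 1) - annihilation (orb v 1) * annihilation (orb u 0) := by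
  rw [LiebThm1.annihilation_mul_annihilation_eq_neg (orb v 0) (orb u 1),
    LiebThm1.annihilation_mul_annihilation_eq_neg (orb v 1) (orb u 0)]
  abel

/-- **The extended-`s` pair field in bond modes**: `Δ_{s*}(p) = (1/√2) Σ_i (1 + conj χ_p(e_i)) T_i(p)` with
`T_i(p) = Σ_x conj χ_p(x) (c_{x↑}c_{x+e_i,↓} − c_{x↓}c_{x+e_i,↑})` (`L ≥ 3`; the backward bonds `x − e_i` are the
forward bonds of `x − e_i`, re-indexed by the translation `x ↦ x + e_i`, which costs the phase `conj χ_p(e_i)`).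
At `p = Q = (π,π)` on an even torus `1 + conj χ_Q(e_i) = 0`: Yang's `[T, η_Q] = 0`. Yang, PRL 63 (1989) 2144,
eq. (6); Scalapino (1995) §2 eq. (2.2). [folklore] -/
theorem pairFieldAt_extendedSWave_eq_sum_single (hL : 3 ≤ L) (p : TorusSite 2 L) :
    pairFieldAt extendedSWave L p = ((1 / Real.sqrt 2 : ℝ) : ℂ) • ∑ i : Fin 2,
      (1 + conj (torusChar p (Pi.single i 1))) • ∑ x : TorusSite 2 L, conj (torusChar p x) •
        (annihilation (orb (FermionTorus.ofTorusSite x) 0) *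
            annihilation (orb (FermionTorus.ofTorusSite (x + Pi.single i 1)) 1) -
          annihilation (orb (FermionTorus.ofTorusSite x) 1) *
            annihilation (orb (FermionTorus.ofTorusSite (x + Pi.single i 1)) 0)) := by
  -- the bond annihilator as a function of two torus sites
  set s : TorusSite 2 L → TorusSite 2 L → Matrix (Finset (Orb (FermionTorus 2 L))) (Finset (Orb (FermionTorus 2 L))) ℂ :=
    fun x y => annihilation (orb (FermionTorus.ofTorusSite x) 0) * annihilation (orb (FermionTorus.ofTorusSite y) 1) -
      annihilation (orb (FermionTorus.ofTorusSite x) 1) * annihilation (orb (FermionTorus.ofTorusSite y) 0) with hs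
  have hsymm : ∀ x y, s x y = s y x := fun x y => ewb_bond_symm _ _
  -- `P^{s*}_x = (1/√2) Σ_i (s x (x+e_i) + s x (x-e_i))`
  have hloc : ∀ x : TorusSite 2 L, localPair extendedSWave L x =
      ((1 / Real.sqrt 2 : ℝ) : ℂ) • ∑ i : Fin 2, (s x (x + Pi.single i 1) + s x (x - Pi.single i 1)) := by
    intro x
    rw [localPair_extendedSWave_eq_smul_sum_adj L hL x]
    congr 1
    rw [FermionTorus.sum_eq_sum_torusSite]
    simp only [fermionTorusGraph_adj, FermionTorus.toTorusSite_ofTorusSite]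
    exact sum_ite_torusGraph_adj_matrix hL x (fun y => s x y)
  -- re-index the backward bonds
  have hback : ∀ i : Fin 2, ∑ x : TorusSite 2 L, conj (torusChar p x) • s x (x - Pi.single i 1) =
      conj (torusChar p (Pi.single i 1)) • ∑ x : TorusSite 2 L, conj (torusChar p x) • s x (x + Pi.single i 1) := by
    intro i
    rw [← Equiv.sum_comp (Equiv.addRight (Pi.single i (1 : ZMod L) : TorusSite 2 L)), Finset.smul_sum]
    refine Finset.sum_congr rfl fun x _ => ?_
    rw [Equiv.coe_addRight, add_sub_cancel_right, torusChar_add_right, map_mul, hsymm, smul_smul, mul_comm]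
  calc pairFieldAt extendedSWave L p
      = ∑ x, conj (torusChar p x) • (((1 / Real.sqrt 2 : ℝ) : ℂ) •
          ∑ i : Fin 2, (s x (x + Pi.single i 1) + s x (x - Pi.single i 1))) := by
        rw [pairFieldAt_eq_sum_torusChar]
        exact Finset.sum_congr rfl fun x _ => by rw [hloc]
    _ = ((1 / Real.sqrt 2 : ℝ) : ℂ) • ∑ x, conj (torusChar p x) •
          ∑ i : Fin 2, (s x (x + Pi.single i 1) + s x (x - Pi.single i 1)) := by
        rw [Finset.smul_sum]
        exact Finset.sum_congr rfl fun x _ => by rw [smul_comm]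
    _ = ((1 / Real.sqrt 2 : ℝ) : ℂ) • ∑ i : Fin 2,
          ((∑ x, conj (torusChar p x) • s x (x + Pi.single i 1)) +
            ∑ x, conj (torusChar p x) • s x (x - Pi.single i 1)) := by
        congr 1
        calc ∑ x, conj (torusChar p x) • ∑ i : Fin 2, (s x (x + Pi.single i 1) + s x (x - Pi.single i 1))
            = ∑ x, ∑ i : Fin 2, conj (torusChar p x) • (s x (x + Pi.single i 1) + s x (x - Pi.single i 1)) :=
              Finset.sum_congr rfl fun x _ => Finset.smul_sum
          _ = ∑ i : Fin 2, ∑ x, conj (torusChar p x) • (s x (x + Pi.single i 1) + s x (x - Pi.single i 1)) :=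
              Finset.sum_comm
          _ = _ := by
              refine Finset.sum_congr rfl fun i _ => ?_
              rw [← Finset.sum_add_distrib]
              exact Finset.sum_congr rfl fun x _ => smul_add _ _ _
    _ = _ := by
        congr 1
        refine Finset.sum_congr rfl fun i _ => ?_
        rw [hback, add_smul, one_smul]

/-- `χ_Q(e_i) = −1` for the corner label `Q = (L/2, L/2)` of an even torus (`e^{iπ} = −1`). [folklore] -/
theorem torusChar_piPi_single (hL : Even L) (i : Fin 2) :
    torusChar (fun _ : Fin 2 => (((L / 2 : ℕ)) : ZMod L)) (Pi.single i 1) = -1 := by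
  rw [torusChar_single_eq_stdAddChar, ZMod.stdAddChar_apply, ZMod.toCircle_natCast]
  obtain ⟨m, hm⟩ := hL
  have hm2 : L / 2 = m := by omega
  have hL0 : (L : ℂ) ≠ 0 := by exact_mod_cast NeZero.ne L
  have hLm : (L : ℂ) = 2 * (m : ℂ) := by rw [hm]; push_cast; ring
  have : (2 * Real.pi * Complex.I * ((L / 2 : ℕ) : ℕ) / (L : ℂ)) = Real.pi * Complex.I := by
    rw [hm2]
    rw [hLm] at hL0 ⊢
    have hm0 : (m : ℂ) ≠ 0 := by
      intro h
      apply hL0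
      rw [h, mul_zero]
    field_simp
  rw [this, Complex.exp_pi_mul_I]

/-- `‖1 + conj χ_{Q+q}(e_i)‖² ≤ |q|²`: at the corner `Q` the bond multiplier of the extended-`s` field vanishes,
linearly in the distance (`χ_{Q+q}(e_i) = −χ_q(e_i)`, `‖χ_q(e_i) − 1‖ ≤ 2π|q̃_i|/L`, `|q|² = momentumNormSq L q`).
[folklore] -/
theorem norm_one_add_conj_torusChar_piPi_add_sq_le (hL : Even L) (q : TorusSite 2 L) (i : Fin 2) :
    ‖1 + conj (torusChar ((fun _ : Fin 2 => (((L / 2 : ℕ)) : ZMod L)) + q) (Pi.single i 1))‖ ^ 2 ≤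
      momentumNormSq L q := by
  rw [torusChar_comm, torusChar_add_right, torusChar_comm _ (fun _ : Fin 2 => (((L / 2 : ℕ)) : ZMod L)),
    torusChar_piPi_single hL, neg_one_mul, map_neg, ← sub_eq_add_neg, torusChar_comm,
    torusChar_single_eq_stdAddChar]
  have h1 : ‖1 - conj (ZMod.stdAddChar (q i) : ℂ)‖ = ‖(ZMod.stdAddChar (q i) : ℂ) - 1‖ := by
    rw [← Complex.norm_conj, map_sub, map_one, Complex.conj_conj, norm_sub_rev]
  rw [h1]
  have h2 := norm_stdAddChar_sub_one_le (q i)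
  have h3 : ‖(ZMod.stdAddChar (q i) : ℂ) - 1‖ ^ 2 ≤ (2 * Real.pi * ((q i).valMinAbs : ℝ) / L) ^ 2 := by
    rw [← sq_abs (2 * Real.pi * _ / _)]
    exact pow_le_pow_left₀ (norm_nonneg _) h2 2
  refine h3.trans ?_
  rw [momentumNormSq_apply, show (2 * Real.pi * ((q i).valMinAbs : ℝ) / L) ^ 2 =
    (2 * Real.pi / (L : ℝ)) ^ 2 * (((q i).valMinAbs : ℤ) : ℝ) ^ 2 by ring]
  exact mul_le_mul_of_nonneg_left (Finset.single_le_sum (f := fun j => (((q j).valMinAbs : ℤ) : ℝ) ^ 2)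
    (fun j _ => sq_nonneg _) (Finset.mem_univ i)) (sq_nonneg _)

/-- `|(ℤ/Lℤ)²| = L²`. [folklore] -/
theorem ewb_card_torusSite_two : ((Fintype.card (TorusSite 2 L) : ℕ) : ℝ) = (L : ℝ) ^ 2 := by
  rw [Fintype.card_fun, ZMod.card, Fintype.card_fin]
  push_cast
  ring

/-- **Parseval bound for operator-valued Fourier modes**: for a family `A_x` of matrices with `‖A_x‖ ≤ K` and its
modes `A(p) = Σ_x conj χ_p(x) A_x`, `Σ_p ‖A(p)ψ‖² = L² Σ_x ‖A_xψ‖² ≤ K² L⁴ ‖ψ‖²` (`sum_conjTranspose_mul_fourierMode`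
in the vector `ψ`, then the operator-norm bound site by site). Kennedy–Lieb–Shastry, PRL 61 (1988) 2582 (sum rule).
[cite: KLS1988PRL, p. 2582] -/
theorem ewb_sum_eucNorm_sq_fourierMode_le {Λ : Type*} [LinearOrder Λ] [Fintype Λ]
    (A : TorusSite 2 L → Matrix (Finset (Orb Λ)) (Finset (Orb Λ)) ℂ) {K : ℝ} (hK : ∀ x, ‖A x‖ ≤ K)
    (ψ : Finset (Orb Λ) → ℂ) :
    ∑ p : TorusSite 2 L, eucNorm ((∑ x : TorusSite 2 L, conj (torusChar p x) • A x) *ᵥ ψ) ^ 2 ≤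
      K ^ 2 * (L : ℝ) ^ 4 * eucNorm ψ ^ 2 := by
  have hP := congrArg (fun T : Matrix (Finset (Orb Λ)) (Finset (Orb Λ)) ℂ => (star ψ ⬝ᵥ (T *ᵥ ψ)).re)
    (sum_conjTranspose_mul_fourierMode (d := 2) (L := L) A)
  simp only [Matrix.sum_mulVec, dotProduct_sum, Complex.re_sum, Matrix.smul_mulVec, dotProduct_smul,
    smul_eq_mul] at hP
  have hL2 : ((L : ℂ) ^ 2) = (((L : ℝ) ^ 2 : ℝ) : ℂ) := by push_cast; ring
  rw [hL2, Complex.re_ofReal_mul, Complex.re_sum] at hP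
  have hsite : ∀ x, eucNorm (A x *ᵥ ψ) ^ 2 ≤ (K * eucNorm ψ) ^ 2 := fun x =>
    pow_le_pow_left₀ (eucNorm_nonneg _)
      ((eucNorm_mulVec_le (A x) ψ).trans (mul_le_mul_of_nonneg_right (hK x) (eucNorm_nonneg ψ))) 2
  calc ∑ p : TorusSite 2 L, eucNorm ((∑ x : TorusSite 2 L, conj (torusChar p x) • A x) *ᵥ ψ) ^ 2
      = ∑ p : TorusSite 2 L, (star ψ ⬝ᵥ
          (((∑ x, conj (torusChar p x) • A x)ᴴ * ∑ y, conj (torusChar p y) • A y) *ᵥ ψ)).re := by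
        simp_rw [eucNorm_sq, star_mulVec_dotProduct_mulVec]
    _ = (L : ℝ) ^ 2 * ∑ x, (star ψ ⬝ᵥ (((A x)ᴴ * A x) *ᵥ ψ)).re := hP
    _ = (L : ℝ) ^ 2 * ∑ x, eucNorm (A x *ᵥ ψ) ^ 2 := by
        simp_rw [eucNorm_sq, star_mulVec_dotProduct_mulVec]
    _ ≤ (L : ℝ) ^ 2 * ∑ _x : TorusSite 2 L, (K * eucNorm ψ) ^ 2 :=
        mul_le_mul_of_nonneg_left (Finset.sum_le_sum fun x _ => hsite x) (by positivity)
    _ = K ^ 2 * (L : ℝ) ^ 4 * eucNorm ψ ^ 2 := by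
        rw [Finset.sum_const, Finset.card_univ, nsmul_eq_mul, ewb_card_torusSite_two]
        ring

/-- The singlet bond annihilator has operator norm `≤ 2` (`‖c‖ ≤ 1`). Koma–Tasaki, PRL 68 (1992) 3248. [folklore] -/
theorem ewb_norm_bond_le {Λ : Type*} [LinearOrder Λ] [Fintype Λ] (u v : Λ) :
    ‖(annihilation (orb u 0) * annihilation (orb v 1) - annihilation (orb u 1) * annihilation (orb v 0) :
        Matrix (Finset (Orb Λ)) (Finset (Orb Λ)) ℂ)‖ ≤ 2 := by
  have h := fun j : Orb Λ => norm_annihilation_le_one (ι := Orb Λ) j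
  have h0 := fun j : Orb Λ => norm_nonneg (annihilation j : Matrix (Finset (Orb Λ)) (Finset (Orb Λ)) ℂ)
  refine (norm_sub_le _ _).trans ?_
  have h1 := (norm_mul_le (annihilation (orb u 0) : Matrix (Finset (Orb Λ)) (Finset (Orb Λ)) ℂ)
    (annihilation (orb v 1))).trans (mul_le_one₀ (h _) (h0 _) (h _))
  have h2 := (norm_mul_le (annihilation (orb u 1) : Matrix (Finset (Orb Λ)) (Finset (Orb Λ)) ℂ)
    (annihilation (orb v 0))).trans (mul_le_one₀ (h _) (h0 _) (h _))
  linarith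

/-- **The extended-`s` pair weight vanishes linearly at `Q = (π,π)`**: for EVERY vector `ψ`, even `L ≥ 4` and every
label `q`, `‖Δ_{s*}(Q+q)ψ‖² ≤ |q|² · Σ_i ‖T_i(Q+q)ψ‖²` (bond modes `T_i` as in
`pairFieldAt_extendedSWave_eq_sum_single`; `|q|² = momentumNormSq L q`). Pure kinematics (no Hamiltonian).
[folklore] -/
theorem eucNorm_sq_pairFieldAt_extendedSWave_piPi_add_le (hL3 : 3 ≤ L) (hL : Even L) (q : TorusSite 2 L)
    (ψ : Fock (Orb (FermionTorus 2 L))) :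
    eucNorm (pairFieldAt extendedSWave L ((fun _ : Fin 2 => (((L / 2 : ℕ)) : ZMod L)) + q) *ᵥ ψ) ^ 2 ≤
      momentumNormSq L q * ∑ i : Fin 2, eucNorm ((∑ x : TorusSite 2 L,
        conj (torusChar ((fun _ : Fin 2 => (((L / 2 : ℕ)) : ZMod L)) + q) x) •
          (annihilation (orb (FermionTorus.ofTorusSite x) 0) *
              annihilation (orb (FermionTorus.ofTorusSite (x + Pi.single i 1)) 1) -
            annihilation (orb (FermionTorus.ofTorusSite x) 1) *
              annihilation (orb (FermionTorus.ofTorusSite (x + Pi.single i 1)) 0))) *ᵥ ψ) ^ 2 := by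
  set Q : TorusSite 2 L := fun _ : Fin 2 => (((L / 2 : ℕ)) : ZMod L) with hQ
  set T : Fin 2 → Matrix (Finset (Orb (FermionTorus 2 L))) (Finset (Orb (FermionTorus 2 L))) ℂ := fun i =>
    ∑ x : TorusSite 2 L, conj (torusChar (Q + q) x) •
      (annihilation (orb (FermionTorus.ofTorusSite x) 0) *
          annihilation (orb (FermionTorus.ofTorusSite (x + Pi.single i 1)) 1) -
        annihilation (orb (FermionTorus.ofTorusSite x) 1) *
          annihilation (orb (FermionTorus.ofTorusSite (x + Pi.single i 1)) 0)) with hT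
  set c : Fin 2 → ℂ := fun i => 1 + conj (torusChar (Q + q) (Pi.single i 1)) with hc
  have hdec : pairFieldAt extendedSWave L (Q + q) = ((1 / Real.sqrt 2 : ℝ) : ℂ) • ∑ i : Fin 2, c i • T i :=
    pairFieldAt_extendedSWave_eq_sum_single hL3 (Q + q)
  -- `‖Δ_{s*}ψ‖ ≤ (1/√2) (‖c₀‖ a₀ + ‖c₁‖ a₁)`
  have hr : ‖((1 / Real.sqrt 2 : ℝ) : ℂ)‖ = 1 / Real.sqrt 2 := by
    rw [Complex.norm_real, Real.norm_eq_abs, abs_of_nonneg (by positivity)]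
  have hX : eucNorm (pairFieldAt extendedSWave L (Q + q) *ᵥ ψ) ≤
      1 / Real.sqrt 2 * (‖c 0‖ * eucNorm (T 0 *ᵥ ψ) + ‖c 1‖ * eucNorm (T 1 *ᵥ ψ)) := by
    rw [hdec, Matrix.smul_mulVec, eucNorm_smul, hr, Matrix.sum_mulVec, Fin.sum_univ_two, Matrix.smul_mulVec,
      Matrix.smul_mulVec]
    refine mul_le_mul_of_nonneg_left ((eucNorm_add_le _ _).trans (add_le_add ?_ ?_)) (by positivity)
    · rw [eucNorm_smul]
    · rw [eucNorm_smul]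
  have hc0 : ‖c 0‖ ^ 2 ≤ momentumNormSq L q := norm_one_add_conj_torusChar_piPi_add_sq_le hL q 0
  have hc1 : ‖c 1‖ ^ 2 ≤ momentumNormSq L q := norm_one_add_conj_torusChar_piPi_add_sq_le hL q 1
  have hsq : (1 / Real.sqrt 2 : ℝ) ^ 2 = 1 / 2 := by
    rw [div_pow, one_pow, Real.sq_sqrt (by norm_num : (0 : ℝ) ≤ 2)]
  have ha0 := eucNorm_nonneg (T 0 *ᵥ ψ)
  have ha1 := eucNorm_nonneg (T 1 *ᵥ ψ)
  have hn0 := norm_nonneg (c 0)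
  have hn1 := norm_nonneg (c 1)
  have hE0 := eucNorm_nonneg (pairFieldAt extendedSWave L (Q + q) *ᵥ ψ)
  have hX2 : eucNorm (pairFieldAt extendedSWave L (Q + q) *ᵥ ψ) ^ 2 ≤
      1 / 2 * (‖c 0‖ * eucNorm (T 0 *ᵥ ψ) + ‖c 1‖ * eucNorm (T 1 *ᵥ ψ)) ^ 2 := by
    rw [← hsq, ← mul_pow]
    exact pow_le_pow_left₀ hE0 hX 2
  rw [Fin.sum_univ_two]
  nlinarith [hX2, hc0, hc1, sq_nonneg (‖c 0‖ * eucNorm (T 1 *ᵥ ψ) - ‖c 1‖ * eucNorm (T 0 *ᵥ ψ)),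
    mul_nonneg hn0 ha0, mul_nonneg hn1 ha1, momentumNormSq_nonneg (L := L) q]

/-- **Window sum of the extended-`s` pair weight near `Q`: `Σ_{|q| ≤ ε} ‖Δ_{s*}(Q+q)ψ‖² ≤ 8 ε² L⁴ ‖ψ‖²`** for
EVERY vector `ψ` (even `L ≥ 4`): the pointwise vanishing at `Q` against the Parseval bound for the two bond modes
(`‖bond‖ ≤ 2`, `L²` sites). Pure kinematics. Kennedy–Lieb–Shastry, PRL 61 (1988) 2582 (sum rule). [folklore] -/
theorem windowSum_extendedSWave_piPi_le (hL3 : 3 ≤ L) (hL : Even L) (ε : ℝ) (ψ : Fock (Orb (FermionTorus 2 L))) :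
    (∑ q : TorusSite 2 L, if momentumNormSq L q ≤ ε ^ 2 then
        eucNorm (pairFieldAt extendedSWave L ((fun _ : Fin 2 => (((L / 2 : ℕ)) : ZMod L)) + q) *ᵥ ψ) ^ 2 else 0) ≤
      8 * ε ^ 2 * (L : ℝ) ^ 4 * eucNorm ψ ^ 2 := by
  set Q : TorusSite 2 L := fun _ : Fin 2 => (((L / 2 : ℕ)) : ZMod L) with hQ
  set B : Fin 2 → TorusSite 2 L → Matrix (Finset (Orb (FermionTorus 2 L))) (Finset (Orb (FermionTorus 2 L))) ℂ :=
    fun i x => annihilation (orb (FermionTorus.ofTorusSite x) 0) *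
        annihilation (orb (FermionTorus.ofTorusSite (x + Pi.single i 1)) 1) -
      annihilation (orb (FermionTorus.ofTorusSite x) 1) *
        annihilation (orb (FermionTorus.ofTorusSite (x + Pi.single i 1)) 0) with hB
  set a : Fin 2 → TorusSite 2 L → ℝ := fun i p =>
    eucNorm ((∑ x : TorusSite 2 L, conj (torusChar p x) • B i x) *ᵥ ψ) ^ 2 with ha
  -- pointwise: each window term is `≤ ε² Σ_i a i (Q+q)`
  have hpt : ∀ q : TorusSite 2 L, (if momentumNormSq L q ≤ ε ^ 2 then
      eucNorm (pairFieldAt extendedSWave L (Q + q) *ᵥ ψ) ^ 2 else 0) ≤ ε ^ 2 * ∑ i : Fin 2, a i (Q + q) := by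
    intro q
    have hsum0 : 0 ≤ ∑ i : Fin 2, a i (Q + q) := Finset.sum_nonneg fun i _ => by positivity
    have hkin : eucNorm (pairFieldAt extendedSWave L (Q + q) *ᵥ ψ) ^ 2 ≤
        momentumNormSq L q * ∑ i : Fin 2, a i (Q + q) :=
      eucNorm_sq_pairFieldAt_extendedSWave_piPi_add_le hL3 hL q ψ
    split_ifs with hq
    · exact hkin.trans (mul_le_mul_of_nonneg_right hq hsum0)
    · positivity
  -- Parseval for each bond mode, after re-indexing `q ↦ Q + q`
  have hpar : ∀ i : Fin 2, ∑ q : TorusSite 2 L, a i (Q + q) ≤ 2 ^ 2 * (L : ℝ) ^ 4 * eucNorm ψ ^ 2 := by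
    intro i
    rw [show ∑ q : TorusSite 2 L, a i (Q + q) = ∑ p : TorusSite 2 L, a i p from
      Equiv.sum_comp (Equiv.addLeft Q) (a i)]
    exact ewb_sum_eucNorm_sq_fourierMode_le (B i) (fun x => ewb_norm_bond_le _ _) ψ
  calc (∑ q : TorusSite 2 L, if momentumNormSq L q ≤ ε ^ 2 then
          eucNorm (pairFieldAt extendedSWave L (Q + q) *ᵥ ψ) ^ 2 else 0)
      ≤ ∑ q : TorusSite 2 L, ε ^ 2 * ∑ i : Fin 2, a i (Q + q) := Finset.sum_le_sum fun q _ => hpt q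
    _ = ε ^ 2 * ∑ i : Fin 2, ∑ q : TorusSite 2 L, a i (Q + q) := by
        rw [← Finset.mul_sum, Finset.sum_comm]
    _ ≤ ε ^ 2 * ∑ _i : Fin 2, 2 ^ 2 * (L : ℝ) ^ 4 * eucNorm ψ ^ 2 :=
        mul_le_mul_of_nonneg_left (Finset.sum_le_sum fun i _ => hpar i) (sq_nonneg ε)
    _ = 8 * ε ^ 2 * (L : ℝ) ^ 4 * eucNorm ψ ^ 2 := by
        rw [Finset.sum_const, Finset.card_univ, Fintype.card_fin, nsmul_eq_mul]
        push_cast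
        ring

end Kinematics

/-! ## §4 The `η`-window bound -/

section Window

/-- **`η`-WINDOW BOUND** (registered support of crux `WindowInfraredBound`, STRATEGY-CENSUS §7 R4; the `η`-channel
calibration of the crux's window functional). On an even torus of side `L ≥ 4`, for every `t`, `U`, every
`N ≥ 2`, every `M` and every normalised `(N, S^z = M)`-sector ground state `ψ` of `hubbardTorus 2 L t U`:
IF the `η`-mode is gapped, `E_N − E_{N−2} < U` (`E_K = minEnergyOn H (szSector K M)`), THEN the on-site pair
structure factor in the punctured window around `Q = (π,π)` obeys the FLAT law
`Σ_{q ≠ 0, |q| ≤ ε} S^{sWave}_ψ(Q + q) ≤ 32 t² ε² L² / (U − (E_N − E_{N−2}))²` for every `ε`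
(`S^g_ψ = pairStructureFactor g L ψ`; pointwise `η`-gap domination `etaGap_mul_eucNorm_pairFieldAt_sWave_le`,
squared and summed against the kinematic window bound `windowSum_extendedSWave_piPi_le`). One KKT inequality with
a lowering eigen-operator of pole order ZERO; no reflection positivity, every coupling and filling. The `d`-wave
channel of the crux has no such operator (its law is the Goldstone `C ε L²`). Shastry, J. Phys. A 30 (1997) L635;
Yang, PRL 63 (1989) 2144; Pitaevskii–Stringari, J. Low Temp. Phys. 85 (1991) 377. [folklore] -/
theorem etaWindowBound : ∀ (L : ℕ) [NeZero L], Even L → 3 ≤ L → ∀ (t U : ℝ) (N : ℕ), 2 ≤ N →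
    ∀ (M : ℝ) (ψ : Fock (Orb (FermionTorus 2 L))), star ψ ⬝ᵥ ψ = 1 →
    IsGroundStateInSector (hubbardTorus 2 L t U) N M ψ →
    (hubbardTorus 2 L t U).minEnergyOn (szSector (Λ := FermionTorus 2 L) N M) -
        (hubbardTorus 2 L t U).minEnergyOn (szSector (Λ := FermionTorus 2 L) (N - 2) M) < U →
    ∀ ε : ℝ, (∑ q : TorusSite 2 L, if q ≠ 0 ∧ momentumNormSq L q ≤ ε ^ 2 then
        pairStructureFactor sWave L ψ ((fun _ : Fin 2 => (((L / 2 : ℕ)) : ZMod L)) + q) else 0) ≤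
      32 * t ^ 2 * ε ^ 2 * (L : ℝ) ^ 2 /
        (U - ((hubbardTorus 2 L t U).minEnergyOn (szSector (Λ := FermionTorus 2 L) N M) -
          (hubbardTorus 2 L t U).minEnergyOn (szSector (Λ := FermionTorus 2 L) (N - 2) M))) ^ 2 := by
  intro L _ hL hL3 t U N hN M ψ hψ1 hgs hgap ε
  set Q : TorusSite 2 L := fun _ : Fin 2 => (((L / 2 : ℕ)) : ZMod L) with hQ
  set γ : ℝ := U - ((hubbardTorus 2 L t U).minEnergyOn (szSector (Λ := FermionTorus 2 L) N M) -
    (hubbardTorus 2 L t U).minEnergyOn (szSector (Λ := FermionTorus 2 L) (N - 2) M)) with hγ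
  have hγ0 : 0 < γ := by rw [hγ]; linarith
  have hL0 : (0 : ℝ) < L := by exact_mod_cast Nat.pos_of_ne_zero (NeZero.ne L)
  have hψ : eucNorm ψ = 1 := eucNorm_eq_one hψ1
  -- pointwise: `γ² ‖Δ_s(p)ψ‖² ≤ 4t² ‖Δ_{s*}(p)ψ‖²`
  have hpt : ∀ p : TorusSite 2 L, γ ^ 2 * eucNorm (pairFieldAt sWave L p *ᵥ ψ) ^ 2 ≤
      4 * t ^ 2 * eucNorm (pairFieldAt extendedSWave L p *ᵥ ψ) ^ 2 := by
    intro p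
    have h := etaGap_mul_eucNorm_pairFieldAt_sWave_le hL3 t U hN hgs p
    rw [← hγ] at h
    have h0 : 0 ≤ γ * eucNorm (pairFieldAt sWave L p *ᵥ ψ) := mul_nonneg hγ0.le (eucNorm_nonneg _)
    have h2 := pow_le_pow_left₀ h0 h 2
    rw [mul_pow, mul_pow, mul_pow, sq_abs] at h2
    linarith [h2]
  -- each punctured-window term against the un-punctured extended-`s` window term
  have hterm : ∀ q : TorusSite 2 L, (if q ≠ 0 ∧ momentumNormSq L q ≤ ε ^ 2 then
      pairStructureFactor sWave L ψ (Q + q) else 0) ≤ 4 * t ^ 2 / (γ ^ 2 * (L : ℝ) ^ 2) *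
        (if momentumNormSq L q ≤ ε ^ 2 then eucNorm (pairFieldAt extendedSWave L (Q + q) *ᵥ ψ) ^ 2 else 0) := by
    intro q
    by_cases hq : momentumNormSq L q ≤ ε ^ 2
    · rw [if_pos hq]
      have hγ2 : (γ ^ 2 : ℝ) ≠ 0 := pow_ne_zero 2 hγ0.ne'
      have hle : pairStructureFactor sWave L ψ (Q + q) ≤ 4 * t ^ 2 / (γ ^ 2 * (L : ℝ) ^ 2) *
          eucNorm (pairFieldAt extendedSWave L (Q + q) *ᵥ ψ) ^ 2 := by
        rw [pairStructureFactor_apply, ← eucNorm_sq, ← mul_div_mul_left _ ((L : ℝ) ^ 2) hγ2]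
        calc γ ^ 2 * eucNorm (pairFieldAt sWave L (Q + q) *ᵥ ψ) ^ 2 / (γ ^ 2 * (L : ℝ) ^ 2)
            ≤ 4 * t ^ 2 * eucNorm (pairFieldAt extendedSWave L (Q + q) *ᵥ ψ) ^ 2 / (γ ^ 2 * (L : ℝ) ^ 2) :=
              div_le_div_of_nonneg_right (hpt (Q + q)) (by positivity)
          _ = _ := by ring
      by_cases hq0 : q ≠ 0
      · rw [if_pos ⟨hq0, hq⟩]
        exact hle
      · rw [if_neg (fun h => hq0 h.1)]
        exact (pairStructureFactor_nonneg sWave L ψ (Q + q)).trans hle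
    · rw [if_neg (fun h => hq h.2), if_neg hq, mul_zero]
  calc (∑ q : TorusSite 2 L, if q ≠ 0 ∧ momentumNormSq L q ≤ ε ^ 2 then
          pairStructureFactor sWave L ψ (Q + q) else 0)
      ≤ ∑ q : TorusSite 2 L, 4 * t ^ 2 / (γ ^ 2 * (L : ℝ) ^ 2) *
          (if momentumNormSq L q ≤ ε ^ 2 then eucNorm (pairFieldAt extendedSWave L (Q + q) *ᵥ ψ) ^ 2 else 0) :=
        Finset.sum_le_sum fun q _ => hterm q
    _ = 4 * t ^ 2 / (γ ^ 2 * (L : ℝ) ^ 2) * ∑ q : TorusSite 2 L,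
          (if momentumNormSq L q ≤ ε ^ 2 then eucNorm (pairFieldAt extendedSWave L (Q + q) *ᵥ ψ) ^ 2 else 0) := by
        rw [Finset.mul_sum]
    _ ≤ 4 * t ^ 2 / (γ ^ 2 * (L : ℝ) ^ 2) * (8 * ε ^ 2 * (L : ℝ) ^ 4 * eucNorm ψ ^ 2) :=
        mul_le_mul_of_nonneg_left (windowSum_extendedSWave_piPi_le hL3 hL ε ψ) (by positivity)
    _ = 32 * t ^ 2 * ε ^ 2 * (L : ℝ) ^ 2 / γ ^ 2 := by
        rw [hψ]
        field_simp
        ring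

end Window

end Summit.HubbardSuperconductivity.HubbardSuperconductivity.Theorems.WindowInfraredBound
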